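import Mathlib
import Summits.Ventures.PercRepro2.ExistsChordRootEdge
import Summits.Ventures.PercRepro2.HMFMinEnd

/-!
# (MIN-END) is a theorem along the root edges at `a₃` (blind cell PercRepro2, night-1 g18;
NIGHT1-G18.md §6)

Along `f = {a₃, a₁}` the covariance form vanishes at the sure end (`D¹ = 0`), so the row (MIN-END)
reads `min (Gc p⁰) 0 ≤ Gc p`: if `Gc p⁰ ≥ 0` this is (HCOV) at `p` (`RootEdge.HCov_of_root_edge`);
if `Gc p⁰ < 0`, the chord of `Gloc` (`gloc_chord_root_edge`) gives
`Gc p ≥ (1 − q)² (Z / Z⁰) · Gc p⁰ ≥ Gc p⁰`.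

* **`Gc_update_one_root`**: `Gc (p[f ↦ 1]) = 0` for `f = {a₃, a₁}`;
* **`minEnd_Gc_root_edge`** / **`minEnd_Gc_root2_edge`**: the row (MIN-END) for `Gc` along every
  edge from `a₃` to a root.

Own code; standard axioms.
-/

namespace Summit.Ventures.PercRepro2

open UnionCluster CovForm

namespace RootEdge

section MinEndRoot

variable {V : Type*} {E : Type*} [Fintype E] [DecidableEq E] [Fintype V] [DecidableEq V]
  {R : Type*} [Field R] [LinearOrder R] [IsStrictOrderedRing R]

variable (p : E → R) (ends : E → Sym2 V) (o : V) {a₁ a₂ a₃ : V} (b : V) {f : E}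

omit [Fintype V] [DecidableEq V] in
/-- At the sure root edge the covariance form vanishes (`D¹ = 0`). -/
lemma Gc_update_one_root (hp : IsProbVec p) (hf : ends f = s(a₃, a₁)) :
    Gc (Function.update p f 1) ends o a₁ a₂ a₃ b = 0 := by
  have hD1 : prob (Function.update p f 1) (PDEvent ends a₁ a₂ a₃) = 0 := by
    simpa using prob_PD_update_one p ends hf Set.univ
  exact Chord.Gc_eq_zero_of_degenerate (hp.update f zero_le_one le_rfl) ends o a₁ a₂ a₃ b
    (by rw [hD1, zero_mul])

/-- **(MIN-END) for `Gc` along a root edge at `a₃`**: `min (Gc p⁰) (Gc p¹) ≤ Gc p` for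
`f = {a₃, a₁}`. -/
theorem minEnd_Gc_root_edge (hp : IsProbVec p) (hf : ends f = s(a₃, a₁)) :
    min (Gc (Function.update p f 0) ends o a₁ a₂ a₃ b)
        (Gc (Function.update p f 1) ends o a₁ a₂ a₃ b) ≤ Gc p ends o a₁ a₂ a₃ b := by
  have hp0 : IsProbVec (Function.update p f 0) := hp.update f le_rfl zero_le_one
  rw [Gc_update_one_root p ends o b hp hf]
  rcases le_or_gt 0 (Gc (Function.update p f 0) ends o a₁ a₂ a₃ b) with h0 | h0
  · -- `Gc p⁰ ≥ 0`: (HCOV) at `p` by the root-edge theorem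
    have h := HCov_of_root_edge p ends o b hp hf h0
    unfold HCov at h
    exact le_trans (min_le_right _ _) h
  · -- `Gc p⁰ < 0`: the chord of `Gloc` gives `Gc p ≥ (1 − q)² (Z / Z⁰) Gc p⁰ ≥ Gc p⁰`
    rw [min_eq_left h0.le]
    have hchord := gloc_chord_root_edge p ends o (a₂ := a₂) b hp hf
    unfold Chord.Gloc at hchord
    have hq0 := hp.nonneg f
    have hq1 := hp.le_one f
    have hZ0 : 0 ≤ prob (Function.update p f 0) (avoidAll ends a₂ {a₁}) := prob_nonneg hp0 _
    have hD0 : 0 ≤ prob (Function.update p f 0) (PDEvent ends a₁ a₂ a₃) := prob_nonneg hp0 _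
    have hZ : 0 ≤ prob p (avoidAll ends a₂ {a₁}) := prob_nonneg hp _
    have hD : prob p (PDEvent ends a₁ a₂ a₃) =
        (1 - p f) * prob (Function.update p f 0) (PDEvent ends a₁ a₂ a₃) :=
      prob_eq_of_update_one_eq_zero p _ (by simpa using prob_PD_update_one p ends hf Set.univ)
    have hZmono : prob p (avoidAll ends a₂ {a₁}) ≤
        prob (Function.update p f 0) (avoidAll ends a₂ {a₁}) :=
      EdmRow.prob_le_prob_update_zero_of_isLowerSet hp (EdmRow.isLowerSet_avoidAll ends a₁ a₂) f
    -- the denominator at `p⁰` is positive (else `Gc p⁰ = 0`)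
    have hden0 : 0 < prob (Function.update p f 0) (PDEvent ends a₁ a₂ a₃) *
        prob (Function.update p f 0) (avoidAll ends a₂ {a₁}) := by
      rcases (mul_nonneg hD0 hZ0).lt_or_eq with h | h
      · exact h
      · exact absurd (Chord.Gc_eq_zero_of_degenerate hp0 ends o a₁ a₂ a₃ b h.symm) (ne_of_lt h0)
    by_cases hden : prob p (PDEvent ends a₁ a₂ a₃) * prob p (avoidAll ends a₂ {a₁}) = 0
    · -- `Gc p = 0 > Gc p⁰`
      rw [Chord.Gc_eq_zero_of_degenerate hp ends o a₁ a₂ a₃ b hden]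
      exact h0.le
    · have hdenpos : 0 < prob p (PDEvent ends a₁ a₂ a₃) * prob p (avoidAll ends a₂ {a₁}) :=
        lt_of_le_of_ne (mul_nonneg (prob_nonneg hp _) hZ) (Ne.symm hden)
      rw [mul_div_assoc', div_le_div_iff₀ hden0 hdenpos] at hchord
      -- `(1 − q) Gc⁰ · D Z ≤ Gc · D⁰ Z⁰` with `D = (1 − q) D⁰` and `Z ≤ Z⁰`, `Gc⁰ < 0`
      rw [hD] at hchord
      -- `Gc · D⁰ Z⁰ ≥ (1 − q)² Gc⁰ D⁰ Z ≥ Gc⁰ D⁰ Z⁰` since `Gc⁰ < 0` and `(1 − q)² Z ≤ Z⁰`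
      have hkey : (1 - p f) ^ 2 * prob p (avoidAll ends a₂ {a₁}) ≤
          prob (Function.update p f 0) (avoidAll ends a₂ {a₁}) := by
        have h1 : (1 - p f) ^ 2 ≤ 1 := by nlinarith
        calc (1 - p f) ^ 2 * prob p (avoidAll ends a₂ {a₁}) ≤ 1 * prob p (avoidAll ends a₂ {a₁}) :=
              mul_le_mul_of_nonneg_right h1 hZ
          _ = prob p (avoidAll ends a₂ {a₁}) := one_mul _
          _ ≤ _ := hZmono
      have hD0pos : 0 < prob (Function.update p f 0) (PDEvent ends a₁ a₂ a₃) := by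
        rcases hD0.lt_or_eq with h | h
        · exact h
        · exact absurd (by rw [← h]; ring) (ne_of_gt hden0)
      have hZ0pos : 0 < prob (Function.update p f 0) (avoidAll ends a₂ {a₁}) := by
        rcases hZ0.lt_or_eq with h | h
        · exact h
        · exact absurd (by rw [← h]; ring) (ne_of_gt hden0)
      -- multiply `hkey` by `−Gc⁰ D⁰ > 0`
      have h2 : Gc (Function.update p f 0) ends o a₁ a₂ a₃ b *
            prob (Function.update p f 0) (PDEvent ends a₁ a₂ a₃) *
            prob (Function.update p f 0) (avoidAll ends a₂ {a₁}) ≤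
          Gc (Function.update p f 0) ends o a₁ a₂ a₃ b *
            prob (Function.update p f 0) (PDEvent ends a₁ a₂ a₃) *
            ((1 - p f) ^ 2 * prob p (avoidAll ends a₂ {a₁})) := by
        have hneg : Gc (Function.update p f 0) ends o a₁ a₂ a₃ b *
            prob (Function.update p f 0) (PDEvent ends a₁ a₂ a₃) ≤ 0 :=
          mul_nonpos_of_nonpos_of_nonneg h0.le hD0
        exact mul_le_mul_of_nonpos_left hkey hneg
      have h3 : Gc (Function.update p f 0) ends o a₁ a₂ a₃ b *
            (prob (Function.update p f 0) (PDEvent ends a₁ a₂ a₃) *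
              prob (Function.update p f 0) (avoidAll ends a₂ {a₁})) ≤
          Gc p ends o a₁ a₂ a₃ b *
            (prob (Function.update p f 0) (PDEvent ends a₁ a₂ a₃) *
              prob (Function.update p f 0) (avoidAll ends a₂ {a₁})) := by
        nlinarith [hchord, h2]
      exact le_of_mul_le_mul_right h3 hden0

/-- **(MIN-END) for `Gc` along the other root edge** (root symmetry). -/
theorem minEnd_Gc_root2_edge (hp : IsProbVec p) (hf : ends f = s(a₃, a₂)) :
    min (Gc (Function.update p f 0) ends o a₁ a₂ a₃ b)
        (Gc (Function.update p f 1) ends o a₁ a₂ a₃ b) ≤ Gc p ends o a₁ a₂ a₃ b := by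
  have h := minEnd_Gc_root_edge p ends o (a₁ := a₂) (a₂ := a₁) b hp hf
  rw [CovForm.Gc_swap (Function.update p f 0) ends o a₁ a₂ a₃ b,
    CovForm.Gc_swap (Function.update p f 1) ends o a₁ a₂ a₃ b, CovForm.Gc_swap p ends o a₁ a₂ a₃ b] at h
  exact h

end MinEndRoot

end RootEdge

end Summit.Ventures.PercRepro2
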